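import Mathlib

/-!
# Giry measurability of the hard-core class — helper 1 for stub `stub_measurableClass`
# (line `purity_stacking`, crux `IsometryAtoms.MinimisingLawsCohesive`, stmt-AtomisticToContinuum-15777)

Main result (anchor): `measurableClass_hardCore_measurableSet` — for `δ > 0` the set of configurations
`{μ : Measure ℝ³ | ∃ S, S is δ-separated ∧ μ = count|S}` (the *hard-core class*, `IsHardCore δ` in
`MinimiserShells.Negative.Rootedness`) is measurable in the Giry σ-algebra on `Measure ℝ³`.

Proof.  Let `c : ℕ → ℝ³` be a dense sequence; the *basic balls* are `closedBall (c i) r`, `r ∈ ℚ`, indexed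
by `t = (i, r) : ℕ × ℚ`, and the *cells* are the finite intersections `⋂ t ∈ T, closedBall (c t.1) t.2`,
`T : Finset (ℕ × ℚ)`.  The event `⋂_T {μ | (some ball of T has radius < δ/2) → μ (cell T) ∈ {0, 1}}` is a
countable intersection of measurable sets, and it EQUALS the hard-core class:
* it contains every `count|S` with `S` `δ`-separated (a ball of radius `< δ/2` meets `S` in at most one
  point: `count_restrict_cell_of_sep`);
* conversely (`exists_sep_of_cells`), for `μ` in the event: an admissible cell of mass `1` contains a
  point `x` with `μ {x} = 1` (`exists_atom_of_nhds_basis`: otherwise every point of the cell has a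
  sub-cell neighbourhood of mass `0`, by continuity from above along shrinking cells, and the cell is
  null by second countability, `measure_null_of_locally_null`); two atoms of mass `1` at distance `< δ`
  would give mass `2` to a basic ball of radius `< δ/2` around their midpoint, so `S := {x | μ {x} = 1}`
  is `δ`-separated; on every basic ball `B` of radius `< δ/2`, `μ|B = (count|S)|B` (both vanish if
  `μ B = 0`, both are the Dirac mass at the atom if `μ B = 1`), and these balls cover `ℝ³`, so
  `μ = count|S` (`eq_count_restrict_of_cover`, via `Measure.ext_iff_of_iUnion_eq_univ`).
-/

noncomputable section

open MeasureTheory Metric Filter Topology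
open scoped ENNReal

namespace Summit.AtomisticToContinuum.Crystallization.Theorems.IsometryAtomsMinimisingLawsCohesive.MeasurableClass

/-! ## Abstract lemmas -/

/-- Giry measurability of `{μ | μ s = a}`. -/
theorem measurableSet_setOf_measure_eq {X : Type*} [MeasurableSpace X] {s : Set X}
    (hs : MeasurableSet s) (a : ℝ≥0∞) : MeasurableSet {μ : Measure X | μ s = a} :=
  (Measure.measurable_coe hs) (measurableSet_singleton a)

/-- **A set of mass one all of whose points have arbitrarily small relative neighbourhoods of mass `0` or
`1` carries an atom of mass one.**  (Otherwise continuity from above makes every point locally null, and a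
locally null set is null in a second-countable space.) -/
theorem exists_atom_of_nhds_basis {X : Type*} [TopologicalSpace X] [SecondCountableTopology X]
    [MeasurableSpace X] {μ : Measure X} {F : Set X} (hF : μ F = 1)
    (h : ∀ x ∈ F, ∃ N : ℕ → Set X, Antitone N ∧ (∀ k, N k ∈ 𝓝 x) ∧
      (∀ k, NullMeasurableSet (F ∩ N k) μ) ∧ (⋂ k, N k) ⊆ {x} ∧
      ∀ k, μ (F ∩ N k) = 0 ∨ μ (F ∩ N k) = 1) :
    ∃ x ∈ F, μ {x} = 1 := by
  by_contra hcon
  push Not at hcon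
  have h0 : μ F = 0 := by
    refine measure_null_of_locally_null _ fun x hx => ?_
    obtain ⟨N, hanti, hnhds, hmeas, hsub, h01⟩ := h x hx
    have hGanti : Antitone fun k => F ∩ N k := fun k k' hkk' =>
      Set.inter_subset_inter_right _ (hanti hkk')
    have hinf : μ (⋂ k, F ∩ N k) = ⨅ k, μ (F ∩ N k) :=
      hGanti.measure_iInter hmeas ⟨0, ne_top_of_le_ne_top (by rw [hF]; exact ENNReal.one_ne_top)
        (measure_mono Set.inter_subset_left)⟩
    obtain ⟨k, hk⟩ : ∃ k, μ (F ∩ N k) = 0 := by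
      by_contra hall
      push Not at hall
      have h1 : ∀ k, μ (F ∩ N k) = 1 := fun k => (h01 k).resolve_left (hall k)
      refine hcon x hx (le_antisymm ?_ ?_)
      · calc μ {x} ≤ μ (F ∩ N 0) :=
            measure_mono (Set.singleton_subset_iff.2 ⟨hx, mem_of_mem_nhds (hnhds 0)⟩)
          _ = 1 := h1 0
      · calc (1 : ℝ≥0∞) = ⨅ k, μ (F ∩ N k) :=
            le_antisymm (le_iInf fun k => (h1 k).ge) (iInf_le_of_le 0 (h1 0).le)
          _ = μ (⋂ k, F ∩ N k) := hinf.symm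
          _ ≤ μ {x} := measure_mono ((Set.iInter_mono fun k => Set.inter_subset_right).trans hsub)
    exact ⟨F ∩ N k, inter_mem_nhdsWithin _ (hnhds k), hk⟩
  rw [h0] at hF
  exact zero_ne_one hF

/-- **Reconstruction of a measure from its unit atoms.**  If a countable measurable cover `B` of the space
is such that each `B i` is either null or has mass `1` with an atom of mass `1` inside, and each `B i`
contains at most one atom of mass `1`, then `μ` is the counting measure of its atoms of mass `1`. -/
theorem eq_count_restrict_of_cover {X : Type*} [MeasurableSpace X] [MeasurableSingletonClass X]
    {ι : Type*} [Countable ι] {μ : Measure X} {B : ι → Set X} (hcover : ⋃ i, B i = Set.univ)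
    (hB : ∀ i, MeasurableSet (B i))
    (h01 : ∀ i, μ (B i) = 0 ∨ (μ (B i) = 1 ∧ ∃ x ∈ B i, μ {x} = 1))
    (huniq : ∀ i, ∀ x ∈ B i, ∀ y ∈ B i, μ {x} = 1 → μ {y} = 1 → x = y) :
    μ = (Measure.count : Measure X).restrict {x | μ {x} = 1} := by
  rw [Measure.ext_iff_of_iUnion_eq_univ hcover]
  intro i
  rw [Measure.restrict_restrict (hB i)]
  rcases h01 i with h0 | ⟨h1, x, hxB, hx1⟩
  · have hempty : B i ∩ {x | μ {x} = 1} = ∅ := by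
      refine Set.eq_empty_of_forall_notMem fun z hz => ?_
      have hz1 : μ {z} = 1 := hz.2
      have : μ {z} ≤ μ (B i) := measure_mono (Set.singleton_subset_iff.2 hz.1)
      rw [h0, hz1] at this
      exact one_ne_zero (le_zero_iff.1 this)
    rw [Measure.restrict_eq_zero.2 h0, hempty, Measure.restrict_empty]
  · have hinter : B i ∩ {x | μ {x} = 1} = {x} := by
      refine Set.eq_singleton_iff_unique_mem.2 ⟨⟨hxB, hx1⟩, fun y hy => ?_⟩
      exact huniq i y hy.1 x hxB hy.2 hx1
    have hdiff : μ (B i \ {x}) = 0 := by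
      rw [measure_sdiff (Set.singleton_subset_iff.2 hxB) (measurableSet_singleton x).nullMeasurableSet
        (by rw [hx1]; exact ENNReal.one_ne_top), h1, hx1, tsub_self]
    have hae : B i =ᵐ[μ] ({x} : Set X) := by
      rw [ae_eq_set]
      exact ⟨hdiff, by rw [Set.sdiff_eq_empty.2 (Set.singleton_subset_iff.2 hxB), measure_empty]⟩
    rw [Measure.restrict_congr_set hae, hinter, Measure.restrict_singleton, Measure.restrict_singleton,
      hx1, Measure.count_singleton]

/-! ## Basic balls of `ℝ³` -/

/-- Near every point there are basic balls of arbitrarily small positive rational radius containing the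
point in their interior. -/
theorem exists_small_ball {c : ℕ → EuclideanSpace ℝ (Fin 3)} (hc : DenseRange c)
    (x : EuclideanSpace ℝ (Fin 3)) {ρ : ℝ} (hρ : 0 < ρ) :
    ∃ t : ℕ × ℚ, 0 < (t.2 : ℝ) ∧ (t.2 : ℝ) < ρ ∧ dist x (c t.1) < t.2 := by
  obtain ⟨r, hr0, hrρ⟩ := exists_rat_btwn hρ
  obtain ⟨i, hi⟩ := Metric.denseRange_iff.1 hc x r hr0
  exact ⟨(i, r), hr0, hrρ, hi⟩

/-- Two points at distance `< δ` lie in a common basic ball of radius `< δ/2`. -/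
theorem exists_common_ball {c : ℕ → EuclideanSpace ℝ (Fin 3)} (hc : DenseRange c) {δ : ℝ}
    {x y : EuclideanSpace ℝ (Fin 3)} (hxy : dist x y < δ) :
    ∃ t : ℕ × ℚ, (t.2 : ℝ) < δ / 2 ∧ dist x (c t.1) ≤ t.2 ∧ dist y (c t.1) ≤ t.2 := by
  obtain ⟨r, hr1, hr2⟩ := exists_rat_btwn (show dist x y / 2 < δ / 2 by linarith)
  have hpos : 0 < (r : ℝ) - dist x y / 2 := by linarith
  obtain ⟨i, hi⟩ := Metric.denseRange_iff.1 hc (midpoint ℝ x y) _ hpos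
  have hxm : dist x (midpoint ℝ x y) = dist x y / 2 := by
    rw [dist_left_midpoint, Real.norm_ofNat]
    ring
  have hym : dist y (midpoint ℝ x y) = dist x y / 2 := by
    rw [dist_right_midpoint, Real.norm_ofNat]
    ring
  refine ⟨(i, r), hr2, ?_, ?_⟩
  · linarith [dist_triangle x (midpoint ℝ x y) (c i)]
  · linarith [dist_triangle y (midpoint ℝ x y) (c i)]

/-- A `δ`-separated set meets a closed ball of radius `< δ/2` in at most one point. -/
theorem subsingleton_inter_of_sep {δ : ℝ} {S : Set (EuclideanSpace ℝ (Fin 3))}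
    (hsep : ∀ x ∈ S, ∀ y ∈ S, x ≠ y → δ ≤ dist x y) {z : EuclideanSpace ℝ (Fin 3)} {r : ℝ}
    (hr : r < δ / 2) : (closedBall z r ∩ S).Subsingleton := by
  intro x hx y hy
  by_contra hxy
  have h1 := hsep x hx.2 y hy.2 hxy
  have hx' := mem_closedBall.1 hx.1
  have hy' := mem_closedBall.1 hy.1
  linarith [dist_triangle_right x y z]

/-- Two distinct points of a set have total mass at most the mass of the set. -/
theorem add_le_measure_of_mem {X : Type*} [MeasurableSpace X] [MeasurableSingletonClass X]
    {μ : Measure X} {x y : X} {B : Set X} (hxy : x ≠ y) (hx : x ∈ B) (hy : y ∈ B) :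
    μ {x} + μ {y} ≤ μ B := by
  rw [← measure_union (Set.disjoint_singleton.2 hxy) (measurableSet_singleton y)]
  exact measure_mono
    (Set.union_subset (Set.singleton_subset_iff.2 hx) (Set.singleton_subset_iff.2 hy))

/-! ## Counting measures of separated sets give mass `0` or `1` to admissible cells -/

/-- The counting measure of a `δ`-separated set gives mass `0` or `1` to every cell one of whose balls
has radius `< δ/2`. -/
theorem count_restrict_cell_of_sep {δ : ℝ} {S : Set (EuclideanSpace ℝ (Fin 3))}
    (hsep : ∀ x ∈ S, ∀ y ∈ S, x ≠ y → δ ≤ dist x y) (c : ℕ → EuclideanSpace ℝ (Fin 3))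
    {T : Finset (ℕ × ℚ)} (hT : ∃ t ∈ T, (t.2 : ℝ) < δ / 2) :
    (Measure.count : Measure (EuclideanSpace ℝ (Fin 3))).restrict S
        (⋂ t ∈ T, closedBall (c t.1) (t.2 : ℝ)) = 0 ∨
      (Measure.count : Measure (EuclideanSpace ℝ (Fin 3))).restrict S
        (⋂ t ∈ T, closedBall (c t.1) (t.2 : ℝ)) = 1 := by
  obtain ⟨t, htT, htr⟩ := hT
  have hmeas : MeasurableSet (⋂ t ∈ T, closedBall (c t.1) (t.2 : ℝ)) :=
    T.measurableSet_biInter fun t _ => measurableSet_closedBall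
  rw [Measure.restrict_apply hmeas]
  have hsub : ((⋂ t ∈ T, closedBall (c t.1) (t.2 : ℝ)) ∩ S).Subsingleton :=
    (subsingleton_inter_of_sep hsep htr).anti
      (Set.inter_subset_inter_left _ (Set.iInter₂_subset t htT))
  rcases hsub.eq_empty_or_singleton with h | ⟨x, hx⟩
  · left
    rw [h, measure_empty]
  · right
    rw [hx, Measure.count_singleton]

/-! ## Measures giving mass `0` or `1` to admissible cells are counting measures of separated sets -/

/-- **Converse.**  If `μ` gives mass `0` or `1` to every cell one of whose balls has radius `< δ/2`
(`δ > 0`, `c` dense), then `μ = count|S` for a `δ`-separated `S` (namely `S = {x | μ {x} = 1}`). -/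
theorem exists_sep_of_cells {δ : ℝ} (hδ : 0 < δ) {c : ℕ → EuclideanSpace ℝ (Fin 3)}
    (hc : DenseRange c) {μ : Measure (EuclideanSpace ℝ (Fin 3))}
    (hH : ∀ T : Finset (ℕ × ℚ), (∃ t ∈ T, (t.2 : ℝ) < δ / 2) →
      μ (⋂ t ∈ T, closedBall (c t.1) (t.2 : ℝ)) = 0 ∨
        μ (⋂ t ∈ T, closedBall (c t.1) (t.2 : ℝ)) = 1) :
    ∃ S : Set (EuclideanSpace ℝ (Fin 3)), (∀ x ∈ S, ∀ y ∈ S, x ≠ y → δ ≤ dist x y) ∧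
      μ = (Measure.count : Measure (EuclideanSpace ℝ (Fin 3))).restrict S := by
  -- single admissible balls have mass `0` or `1`
  have hball01 : ∀ t : ℕ × ℚ, (t.2 : ℝ) < δ / 2 →
      μ (closedBall (c t.1) t.2) = 0 ∨ μ (closedBall (c t.1) t.2) = 1 := by
    intro t ht
    have := hH {t} ⟨t, Finset.mem_singleton_self t, ht⟩
    rwa [Finset.set_biInter_singleton t (fun s : ℕ × ℚ => closedBall (c s.1) (s.2 : ℝ))] at this
  -- two atoms of mass one are `δ` apart
  have htwo : ∀ x y : EuclideanSpace ℝ (Fin 3), μ {x} = 1 → μ {y} = 1 → x ≠ y → δ ≤ dist x y := by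
    intro x y hx hy hxy
    by_contra hlt
    push Not at hlt
    obtain ⟨t, htr, hxt, hyt⟩ := exists_common_ball hc hlt
    have h2 : μ {x} + μ {y} ≤ μ (closedBall (c t.1) t.2) :=
      add_le_measure_of_mem hxy (mem_closedBall.2 hxt) (mem_closedBall.2 hyt)
    rw [hx, hy] at h2
    rcases hball01 t htr with h | h <;> rw [h] at h2 <;> norm_num at h2
  -- an admissible cell of mass one carries an atom of mass one
  have hatom : ∀ T : Finset (ℕ × ℚ), (∃ t ∈ T, (t.2 : ℝ) < δ / 2) →
      μ (⋂ t ∈ T, closedBall (c t.1) (t.2 : ℝ)) = 1 →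
        ∃ x ∈ ⋂ t ∈ T, closedBall (c t.1) (t.2 : ℝ), μ {x} = 1 := by
    intro T hT h1
    refine exists_atom_of_nhds_basis h1 fun x hx => ?_
    -- a neighbourhood basis of `x` made of basic balls with radii `→ 0`
    choose t _ htρ htx using fun k : ℕ =>
      exists_small_ball hc x (ρ := min (δ / 2) (1 / ((k : ℝ) + 1))) (by positivity)
    refine ⟨fun k => ⋂ s ∈ (Finset.range (k + 1)).image t, closedBall (c s.1) (s.2 : ℝ),
      ?_, ?_, ?_, ?_, ?_⟩
    · intro k k' hkk' y hy
      simp only [Set.mem_iInter] at hy ⊢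
      intro s hs
      refine hy s ?_
      rw [Finset.mem_image] at hs ⊢
      obtain ⟨j, hj, rfl⟩ := hs
      exact ⟨j, Finset.mem_range.2 (lt_of_lt_of_le (Finset.mem_range.1 hj) (by omega)), rfl⟩
    · intro k
      refine (Filter.biInter_finset_mem _).2 fun s hs => ?_
      rw [Finset.mem_image] at hs
      obtain ⟨j, -, rfl⟩ := hs
      exact closedBall_mem_nhds_of_mem (htx j)
    · intro k
      rw [← Finset.set_biInter_inter]
      exact (Finset.measurableSet_biInter _ fun s _ => measurableSet_closedBall).nullMeasurableSet
    · intro y hy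
      rw [Set.mem_iInter] at hy
      have hbound : ∀ k : ℕ, dist y x ≤ 2 * (1 / ((k : ℝ) + 1)) := by
        intro k
        have hyk : y ∈ closedBall (c (t k).1) ((t k).2 : ℝ) := by
          have := hy k
          simp only [Set.mem_iInter] at this
          exact this (t k) (Finset.mem_image.2 ⟨k, Finset.self_mem_range_succ k, rfl⟩)
        have h1 : dist y (c (t k).1) ≤ (t k).2 := mem_closedBall.1 hyk
        have h2 := htx k
        have h3 : ((t k).2 : ℝ) < 1 / ((k : ℝ) + 1) := lt_of_lt_of_le (htρ k) (min_le_right _ _)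
        linarith [dist_triangle_right y x (c (t k).1)]
      have hlim := le_of_tendsto_of_tendsto' tendsto_const_nhds
        (tendsto_one_div_add_atTop_nhds_zero_nat.const_mul (2 : ℝ)) hbound
      rw [mul_zero] at hlim
      exact Set.mem_singleton_iff.2 (dist_le_zero.1 hlim)
    · intro k
      rw [← Finset.set_biInter_inter]
      exact hH _ (hT.imp fun s hs => ⟨Finset.mem_union_left _ hs.1, hs.2⟩)
  -- reconstruct `μ` from its atoms on the cover by admissible balls
  have hcover : ⋃ a : {t : ℕ × ℚ // 0 < (t.2 : ℝ) ∧ (t.2 : ℝ) < δ / 2},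
      closedBall (c a.1.1) (a.1.2 : ℝ) = Set.univ := by
    refine Set.eq_univ_of_forall fun x => ?_
    obtain ⟨t, ht0, htδ, hxt⟩ := exists_small_ball hc x (half_pos hδ)
    exact Set.mem_iUnion.2 ⟨⟨t, ht0, htδ⟩, mem_closedBall.2 hxt.le⟩
  refine ⟨{x | μ {x} = 1}, fun x hx y hy hxy => htwo x y hx hy hxy, ?_⟩
  refine eq_count_restrict_of_cover hcover (fun _ => measurableSet_closedBall) (fun a => ?_)
    (fun a x hx y hy hx1 hy1 => ?_)
  · rcases hball01 a.1 a.2.2 with h0 | h1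
    · exact Or.inl h0
    · refine Or.inr ⟨h1, ?_⟩
      have := hatom {a.1} ⟨a.1, Finset.mem_singleton_self _, a.2.2⟩
      rw [Finset.set_biInter_singleton a.1 (fun s : ℕ × ℚ => closedBall (c s.1) (s.2 : ℝ))] at this
      exact this h1
  · by_contra hxy
    have h2 : μ {x} + μ {y} ≤ μ (closedBall (c a.1.1) a.1.2) := add_le_measure_of_mem hxy hx hy
    rw [hx1, hy1] at h2
    rcases hball01 a.1 a.2.2 with h | h <;> rw [h] at h2 <;> norm_num at h2

/-- **Giry measurability of the hard-core class** (anchor of this helper file).  For `δ > 0`, the set of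
counting measures of `δ`-separated subsets of `ℝ³` (i.e. `{μ | IsHardCore δ μ}`) is measurable: it is the
countable intersection, over the cells `T` having a ball of radius `< δ/2`, of the measurable events
`{μ | μ (cell T) ∈ {0, 1}}`. -/
theorem measurableClass_hardCore_measurableSet : ∀ δ : ℝ, 0 < δ →
    MeasurableSet {μ : MeasureTheory.Measure (EuclideanSpace ℝ (Fin 3)) |
      ∃ S : Set (EuclideanSpace ℝ (Fin 3)), (∀ x ∈ S, ∀ y ∈ S, x ≠ y → δ ≤ dist x y) ∧
        μ = (MeasureTheory.Measure.count :
          MeasureTheory.Measure (EuclideanSpace ℝ (Fin 3))).restrict S} := by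
  intro δ hδ
  have hc : DenseRange (TopologicalSpace.denseSeq (EuclideanSpace ℝ (Fin 3))) :=
    TopologicalSpace.denseRange_denseSeq _
  set c := TopologicalSpace.denseSeq (EuclideanSpace ℝ (Fin 3)) with hc_def
  have key : {μ : Measure (EuclideanSpace ℝ (Fin 3)) |
      ∃ S : Set (EuclideanSpace ℝ (Fin 3)), (∀ x ∈ S, ∀ y ∈ S, x ≠ y → δ ≤ dist x y) ∧
        μ = (Measure.count : Measure (EuclideanSpace ℝ (Fin 3))).restrict S} =
      ⋂ T : Finset (ℕ × ℚ), {μ | (∃ t ∈ T, (t.2 : ℝ) < δ / 2) →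
        μ (⋂ t ∈ T, closedBall (c t.1) (t.2 : ℝ)) = 0 ∨
          μ (⋂ t ∈ T, closedBall (c t.1) (t.2 : ℝ)) = 1} := by
    ext μ
    simp only [Set.mem_setOf_eq, Set.mem_iInter]
    constructor
    · rintro ⟨S, hS, rfl⟩ T hT
      exact count_restrict_cell_of_sep hS c hT
    · exact fun hH => exists_sep_of_cells hδ hc hH
  rw [key]
  refine MeasurableSet.iInter fun T => ?_
  have hmeas : MeasurableSet (⋂ t ∈ T, closedBall (c t.1) (t.2 : ℝ)) :=
    T.measurableSet_biInter fun t _ => measurableSet_closedBall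
  have hsplit : {μ : Measure (EuclideanSpace ℝ (Fin 3)) | (∃ t ∈ T, (t.2 : ℝ) < δ / 2) →
      μ (⋂ t ∈ T, closedBall (c t.1) (t.2 : ℝ)) = 0 ∨
        μ (⋂ t ∈ T, closedBall (c t.1) (t.2 : ℝ)) = 1} =
      {μ | ¬ (∃ t ∈ T, (t.2 : ℝ) < δ / 2)} ∪
        ({μ | μ (⋂ t ∈ T, closedBall (c t.1) (t.2 : ℝ)) = 0} ∪
          {μ | μ (⋂ t ∈ T, closedBall (c t.1) (t.2 : ℝ)) = 1}) := by
    ext μ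
    simp only [Set.mem_setOf_eq, Set.mem_union, imp_iff_not_or]
  rw [hsplit]
  exact (MeasurableSet.const _).union
    ((measurableSet_setOf_measure_eq hmeas 0).union (measurableSet_setOf_measure_eq hmeas 1))

end Summit.AtomisticToContinuum.Crystallization.Theorems.IsometryAtomsMinimisingLawsCohesive.MeasurableClass

end
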